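import Summits.Parity.GeneralizedHardyLittlewood.Theorems.FordMaynardSieveConst01651SieveConst01651ConeKernel
import Summits.Parity.GeneralizedHardyLittlewood.Theorems.FordMaynardSieveConst01651SieveConst01651ConeCuts
import HarnessLib

/-!
# Route `FordMaynardSieveConst01651`, target `SieveConst01651` (stmt-Parity-19185), line `sieve_decomposition`,
# stub `stub_coneCertClosed`: the kernel normal form AT `ν₀ = 1651/10000`

Helper file (def-free), continuation of `…ConeKernel` / `…ConeCuts` (K. Ford, J. Maynard, *On the theory of prime
producing sieves*, arXiv:2407.14368, Theorem 7.3 (a), §8.2).  For the cone data `g₀` of `stub_coneCertClosed`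
(piecewise constant on the ordered cone, `g₀(∅) = 1`, closed support `xᵢ > ν₀`, `|x| ≤ 1/2` on ordered vectors) the
last conjunct `0 < sieveBoundG1 ν₀ g₀` concerns the EXPLICIT finite expression

`V(ν₀, g₀) = 1 + ∑_{k=2}^{6} (1/k!)·( F_k(1) + ∑_{1 ≤ r ≤ min(k−1, 3)} C(k,r)·∫_{t∈(0,1]} (r!·S⁰_r(t))·F_{k−r}(1−t) dt )`

(`sieveBoundG1_coneData_01651`): `⌊1/ν₀⌋ = 6` (`floor_inv_nu01651`) and the dimensions `r ≥ 4` drop out because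
`4ν₀ > 1/2` (`sliceFnOrd_eq_zero_of_dim`).  Twelve one-dimensional integrals (`(k,r)` with `2 ≤ k ≤ 6`,
`1 ≤ r ≤ min(k−1,3)`) of the table's ordered slice functions `S⁰_1, S⁰_2, S⁰_3` against the kernels `F_1,…,F_5`, plus the
five constants `F_k(1)`.

References: [FordMaynard2024PrimeSieves] arXiv:2407.14368, Theorem 7.3 (a), §8.2 ("at most three components",
"at most 6 components").
-/

noncomputable section

open MeasureTheory Set Finset
open scoped Classical
open Literature.NumberTheory.Sieve Literature.NumberTheory.Sieve.FordMaynard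

namespace Summit.Parity.GeneralizedHardyLittlewood.FordMaynardSieveConst01651SieveConst01651

/-- `⌊1/ν₀⌋ = 6` at `ν₀ = 0.1651` (vectors of `ℋ` have at most six components).
[cite: FordMaynard2024PrimeSieves, §8.2 ("such vectors have at most 6 components")] -/
theorem floor_inv_nu01651 : ⌊1 / (1651 / 10000 : ℝ)⌋₊ = 6 := by
  rw [Nat.floor_eq_iff (by norm_num)]
  constructor <;> norm_num

/-- **The certificate value at `ν₀ = 0.1651` as twelve one-dimensional integrals.** For cone data `g₀` piecewise
constant on the ordered cone with `g₀(∅) = 1` and the closed support clause at `ν₀ = 1651/10000`: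
`V(ν₀, g₀) = 1 + ∑_{k=2}^{6} (1/k!)·( F_k(1) + ∑_{r ∈ [1, min(k,4))} C(k,r)·∫_{(0,1]} (r!·S⁰_r(t))·F_{k−r}(1−t) dt )`,
`S⁰_r(t) = ∫_{|v|=t} 𝟙[vᵢ>ν₀, v monotone] g₀,ᵣ(v)/∏vᵢ`, `F_m(s) = ∫_{|u|=s} 𝟙[uⱼ>ν₀]/∏uⱼ`.
[cite: FordMaynard2024PrimeSieves, Theorem 7.3 (a) with §8.2] -/
theorem sieveBoundG1_coneData_01651 {g₀ : VecFn} (hpc : IsPiecewiseConstOnCone g₀) (h0 : ∀ e : Fin 0 → ℝ, g₀ 0 e = 1)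
    (hsupp : ∀ (k : ℕ) (x : Fin k → ℝ), Monotone x → g₀ k x ≠ 0 →
      k = 0 ∨ ((∀ i, (1651 / 10000 : ℝ) < x i) ∧ ∑ i, x i ≤ 1 / 2)) :
    sieveBoundG1 (1651 / 10000) g₀ = 1 + ∑ k ∈ Icc 2 6, (1 / (k.factorial : ℝ)) *
      (sliceIntegral k 1 (fun u => if ∀ i, (1651 / 10000 : ℝ) < u i then 1 / ∏ i, u i else 0) +
        ∑ r ∈ Ico 1 (min k 4), (k.choose r : ℝ) * ∫ t in Set.Ioc 0 1,
          ((r.factorial : ℝ) * sliceIntegral r t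
              (fun v => if (∀ i, (1651 / 10000 : ℝ) < v i) ∧ Monotone v then g₀ r v / ∏ i, v i else 0)) *
            sliceIntegral (k - r) (1 - t) (fun u => if ∀ i, (1651 / 10000 : ℝ) < u i then 1 / ∏ i, u i else 0)) := by
  rw [sieveBoundG1_coneData_eq_kernelForm (by norm_num) hpc hsupp, floor_inv_nu01651, h0]
  simp only [one_mul]
  congr 1
  refine Finset.sum_congr rfl fun k hk => ?_
  have hk6 : k ≤ 6 := (Finset.mem_Icc.1 hk).2
  congr 2
  -- the dimensions `r ≥ 4` vanish: `4 · 0.1651 ≥ 1/2`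
  rw [← Finset.sum_Ico_consecutive _ (show 1 ≤ min k 4 by have := (Finset.mem_Icc.1 hk).1; omega)
    (min_le_left k 4)]
  conv_rhs => rw [← add_zero (∑ r ∈ Ico 1 (min k 4), _)]
  congr 1
  refine Finset.sum_eq_zero fun r hr => ?_
  have hr4 : 4 ≤ r := by
    have h1 := (Finset.mem_Ico.1 hr).1
    have h2 := (Finset.mem_Ico.1 hr).2
    rcases le_or_gt k 4 with hk4 | hk4
    · rw [min_eq_left hk4] at h1; omega
    · rw [min_eq_right hk4.le] at h1; omega
  have hzero : ∀ t : ℝ, sliceIntegral r t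
      (fun v => if (∀ i, (1651 / 10000 : ℝ) < v i) ∧ Monotone v then g₀ r v / ∏ i, v i else 0) = 0 := by
    intro t
    refine sliceFnOrd_eq_zero_of_dim hsupp (by omega) ?_ t
    have : (4 : ℝ) ≤ r := by exact_mod_cast hr4
    nlinarith
  simp only [hzero, mul_zero, zero_mul, MeasureTheory.integral_zero]

end Summit.Parity.GeneralizedHardyLittlewood.FordMaynardSieveConst01651SieveConst01651

end
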